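import Mathlib.Analysis.Calculus.Deriv.Star
import Literature.Probability.RandomPlanarGeometry.ConformalRectangleProofs
import Literature.Probability.RandomPlanarGeometry.UpperHalfPlaneAutomorphisms
import HarnessLib

/-!
# Reflection-symmetric conformal rectangles have modulus `1/2`

Topic `Literature/Probability/RandomPlanarGeometry` (conformal rectangles and their cross-ratio
modulus, `ConformalRectangle.lean`). This file proves the classical symmetry principle for the
conformal modulus:

* `Literature.Probability.RandomPlanarGeometry.ConformalRectangle.crossRatio_eq_half_of_antiAffine`: if a conformal rectangle
  `(D; a, b, c, d)` admits an anti-conformal affine involution `ρ z = u z̄ + v` of the plane with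
  `ρ(D) ⊆ D`, `ρ a = a`, `ρ c = c`, `ρ b = d`, then EVERY uniformizing datum `(φ, x)` has
  Cardy cross-ratio `crossRatio x = 1/2` ("a conformal rectangle with a symmetry exchanging `b, d`
  and fixing `a, c` is conformally a square").

Proof (Ahlfors (1979), Ch. 4 §6.5 reflection principle, in the elementary form that needs no
analytic continuation): `ψ = ρ ∘ φ ∘ κ`, `κ z = -z̄`, is again a conformal equivalence `ℍₒ → D`
(`Literature.Probability.RandomPlanarGeometry.ConformalEquiv.antiConj`), with boundary values `a, d, c, b` at `-x₀, -x₁, -x₂, -x₃`, i.e.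
it uniformizes `(D; a, b, c, d)` with the boundary tuple `(-x₀, -x₃, -x₂, -x₁)`, which is
monotone only up to a cyclic rotation; a real Möbius map `z ↦ c - 1/z` of `ℍₒ` renormalises it
(`Literature.Probability.RandomPlanarGeometry.ConformalRectangle.exists_isUniformizing_of_cyclic`) without changing the cross-ratio
(`Literature.Probability.RandomPlanarGeometry.crossRatio_inv`), and conformal invariance of the cross-ratio
(`ConformalRectangle.crossRatio_eq_of_isUniformizing`, proved in the tree from Carathéodory's
theorem: `crossRatio_eq_of_isUniformizing_of_disc exists_continuousOn_extension_holds`) gives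
`η = 1 - η` (`Literature.Probability.RandomPlanarGeometry.crossRatio_perm_0321`).

Also provided: the cross-ratio identities `crossRatio_inv`, `crossRatio_perm_0321`, the Möbius
renormalisation `exists_isUniformizing_of_cyclic`, the reflected uniformizing map
`ConformalEquiv.antiConj`, and `ConformalRectangle.mapsTo_antiAffine_sq_ball` (the reflection
`z ↦ w² z̄` preserves the unit disc), used for the disc rectangles `(𝔻; w, w e^{iσ}, -w, w e^{-iσ})`.

## Mathlib

USED: `differentiableAt_conj_conj_iff` (`Mathlib.Analysis.Calculus.Deriv.Star`: `conj ∘ f ∘ conj`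
is holomorphic iff `f` is), `Matrix.SpecialLinearGroup`, `Fin.strictMono_iff_lt_succ`,
`Fin.strictAnti_iff_succ_lt`. Tree: `Literature.Probability.RandomPlanarGeometry.ConformalEquiv.moebius`, `Literature.Probability.RandomPlanarGeometry.hasBoundaryValue_of_moebius`,
`Literature.Probability.RandomPlanarGeometry.ConformalRectangle.crossRatio_eq_of_isUniformizing_of_disc`,
`Literature.Probability.RandomPlanarGeometry.JordanDomain.exists_continuousOn_extension_holds`.

## References

* L. V. Ahlfors, *Complex Analysis*, 3rd ed. (1979), Ch. 3 §3.1 (cross-ratio), Ch. 4 §6.5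
  (reflection principle), Ch. 6 §1.1.
* V. Beffara, *Is critical 2D percolation universal?*, Progr. Probab. 60 (2008), proof of Prop. 4
  ("By symmetry, the conformal rectangles `(Q,0,1,1+i,i)` and `(Q,1,1+i,i,0)` have the same
  modulus"), arXiv:0708.3908, p. 6.
-/

noncomputable section

open Set Filter Topology Complex Metric
open UpperHalfPlane (upperHalfPlaneSet isOpen_upperHalfPlaneSet)
open scoped ComplexConjugate

namespace Literature.Probability.RandomPlanarGeometry

/-! ### Cross-ratio identities -/

/-- The cross-ratio is invariant under the inversion `t ↦ t⁻¹` applied to four non-zero points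
(with the translations and dilations of `crossRatio_affine` this gives invariance under all real
Möbius maps away from their pole). Ahlfors (1979), Ch. 3 §3.1. [cite: AhlforsCA1979, Ch. 3 §3.1] -/
theorem crossRatio_inv (x : Fin 4 → ℝ) (hx : ∀ i, x i ≠ 0) (h02 : x 0 ≠ x 2) (h13 : x 1 ≠ x 3) :
    crossRatio (fun i ↦ (x i)⁻¹) = crossRatio x := by
  have h0 := hx 0; have h1 := hx 1; have h2 := hx 2; have h3 := hx 3
  have hd : (x 0 - x 2) * (x 1 - x 3) ≠ 0 := mul_ne_zero (sub_ne_zero.2 h02) (sub_ne_zero.2 h13)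
  have hd' : ((x 0)⁻¹ - (x 2)⁻¹) * ((x 1)⁻¹ - (x 3)⁻¹) ≠ 0 := by
    refine mul_ne_zero (sub_ne_zero.2 fun h ↦ h02 (inv_injective h))
      (sub_ne_zero.2 fun h ↦ h13 (inv_injective h))
  unfold crossRatio
  rw [div_eq_div_iff hd' hd]
  field_simp
  ring

/-- The cyclic identity behind "the conjugate marking has modulus `1 - η`": for four distinct
points, the cross-ratio of `(x₀, x₃, x₂, x₁)` is `1 - crossRatio x`
(`(x₀-x₁)(x₂-x₃) + (x₀-x₃)(x₁-x₂) = (x₀-x₂)(x₁-x₃)`). Ahlfors (1979), Ch. 3 §3.1. [cite: AhlforsCA1979, Ch. 3 §3.1] -/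
theorem crossRatio_perm_0321 (x : Fin 4 → ℝ) (h02 : x 0 ≠ x 2) (h13 : x 1 ≠ x 3) :
    crossRatio ![x 0, x 3, x 2, x 1] = 1 - crossRatio x := by
  have ha : x 0 - x 2 ≠ 0 := sub_ne_zero.2 h02
  have hb : x 1 - x 3 ≠ 0 := sub_ne_zero.2 h13
  have hc : x 3 - x 1 ≠ 0 := sub_ne_zero.2 (Ne.symm h13)
  unfold crossRatio
  simp only [Matrix.cons_val_zero, Matrix.cons_val_one, Matrix.cons_val]
  field_simp
  ring

/-- The cross-ratio of the negated, pair-swapped tuple `(-x₀, -x₃, -x₂, -x₁)` is `1 - crossRatio x`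
(negation invariance `crossRatio_neg` and `crossRatio_perm_0321`). [folklore] -/
theorem crossRatio_neg_perm_0321 (x : Fin 4 → ℝ) (h02 : x 0 ≠ x 2) (h13 : x 1 ≠ x 3) :
    crossRatio ![-x 0, -x 3, -x 2, -x 1] = 1 - crossRatio x := by
  have h : (![-x 0, -x 3, -x 2, -x 1] : Fin 4 → ℝ) = -![x 0, x 3, x 2, x 1] := by
    ext i; fin_cases i <;> simp
  rw [h, crossRatio_neg, crossRatio_perm_0321 x h02 h13]

/-! ### Möbius renormalisation of a cyclically ordered boundary tuple -/

/-- The matrix `(c, -1; 1, 0) ∈ SL(2, ℝ)` of the Möbius map `z ↦ c - 1/z` of `ℍₒ`, which sends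
the real point `(c - y)⁻¹` to `y` and `0` to `∞`. [folklore] -/
def invShiftSL (c : ℝ) : Matrix.SpecialLinearGroup (Fin 2) ℝ :=
  ⟨!![c, -1; 1, 0], by simp [Matrix.det_fin_two_of]⟩

/-- Entry `(0,0)` of `invShiftSL c` is `c`. [folklore] -/
@[simp] theorem invShiftSL_apply_00 (c : ℝ) : (invShiftSL c) 0 0 = c := rfl

/-- Entry `(0,1)` of `invShiftSL c` is `-1`. [folklore] -/
@[simp] theorem invShiftSL_apply_01 (c : ℝ) : (invShiftSL c) 0 1 = -1 := rfl

/-- Entry `(1,0)` of `invShiftSL c` is `1`. [folklore] -/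
@[simp] theorem invShiftSL_apply_10 (c : ℝ) : (invShiftSL c) 1 0 = 1 := rfl

/-- Entry `(1,1)` of `invShiftSL c` is `0`. [folklore] -/
@[simp] theorem invShiftSL_apply_11 (c : ℝ) : (invShiftSL c) 1 1 = 0 := rfl

namespace ConformalRectangle

/-- **Möbius renormalisation.** If a conformal equivalence `φ : ℍₒ → D` has boundary values the
four marked points `D.pt i` at real points `y i` which are increasing only *cyclically*, in the
pattern `y₁ < y₂ < y₃ < y₀` or its reverse `y₀ < y₃ < y₂ < y₁` (the point `∞` of `∂ℍₒ` sitting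
between `y₀` and its cyclic neighbour), then precomposing with the Möbius automorphism
`z ↦ c - 1/z` of `ℍₒ`, `c` strictly between `y₃` and `y₀`, gives a genuine uniformizing datum
`(φ', x)`, `x i = (c - y i)⁻¹`, with the same cross-ratio. Ahlfors (1979), Ch. 3 §3.1 and Ch. 6
§1.1 (three real parameters of `Aut ℍₒ`). [cite: AhlforsCA1979, Ch. 3 §3.1] -/
theorem exists_isUniformizing_of_cyclic (R : ConformalRectangle)
    (φ : ConformalEquiv upperHalfPlaneSet R.carrier) (y : Fin 4 → ℝ)
    (hbv : ∀ i, φ.HasBoundaryValue (y i) (R.pt i))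
    (hy : (y 1 < y 2 ∧ y 2 < y 3 ∧ y 3 < y 0) ∨ (y 0 < y 3 ∧ y 3 < y 2 ∧ y 2 < y 1)) :
    ∃ (φ' : ConformalEquiv upperHalfPlaneSet R.carrier) (x : Fin 4 → ℝ),
      R.IsUniformizing φ' x ∧ crossRatio x = crossRatio y := by
  set c : ℝ := (y 3 + y 0) / 2 with hc
  have hcy0 : c - y 0 ≠ 0 := by
    rcases hy with ⟨h1, h2, h3⟩ | ⟨h1, h2, h3⟩ <;> rw [hc] <;> intro h <;> linarith
  have hcy1 : c - y 1 ≠ 0 := by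
    rcases hy with ⟨h1, h2, h3⟩ | ⟨h1, h2, h3⟩ <;> rw [hc] <;> intro h <;> linarith
  have hcy2 : c - y 2 ≠ 0 := by
    rcases hy with ⟨h1, h2, h3⟩ | ⟨h1, h2, h3⟩ <;> rw [hc] <;> intro h <;> linarith
  have hcy3 : c - y 3 ≠ 0 := by
    rcases hy with ⟨h1, h2, h3⟩ | ⟨h1, h2, h3⟩ <;> rw [hc] <;> intro h <;> linarith
  have hcy : ∀ i, c - y i ≠ 0 := by
    intro i
    fin_cases i
    · exact hcy0
    · exact hcy1
    · exact hcy2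
    · exact hcy3
  set x : Fin 4 → ℝ := fun i ↦ (c - y i)⁻¹ with hx
  have hx0 : ∀ i, x i ≠ 0 := fun i ↦ inv_ne_zero (hcy i)
  set φ' : ConformalEquiv upperHalfPlaneSet R.carrier := (ConformalEquiv.moebius (invShiftSL c)).trans φ
  refine ⟨φ', x, ⟨?_, fun i ↦ ?_⟩, ?_⟩
  · -- monotonicity of `x i = (c - y i)⁻¹`
    rcases hy with ⟨h1, h2, h3⟩ | ⟨h1, h2, h3⟩
    · left
      have hc0 : c - y 0 < 0 := by rw [hc]; linarith
      have hc3 : 0 < c - y 3 := by rw [hc]; linarith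
      have hc2 : c - y 3 < c - y 2 := by linarith
      have hc1 : c - y 2 < c - y 1 := by linarith
      refine Fin.strictMono_iff_lt_succ.2 fun i ↦ ?_
      fin_cases i
      · show (c - y 0)⁻¹ < (c - y 1)⁻¹
        exact (inv_neg''.2 hc0).trans (inv_pos.2 (hc3.trans (hc2.trans hc1)))
      · show (c - y 1)⁻¹ < (c - y 2)⁻¹
        exact inv_strictAntiOn (hc3.trans hc2) ((hc3.trans hc2).trans hc1) hc1
      · show (c - y 2)⁻¹ < (c - y 3)⁻¹
        exact inv_strictAntiOn hc3 (hc3.trans hc2) hc2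
    · right
      have hc0 : 0 < c - y 0 := by rw [hc]; linarith
      have hc3 : c - y 3 < 0 := by rw [hc]; linarith
      have hc2 : c - y 2 < c - y 3 := by linarith
      have hc1 : c - y 1 < c - y 2 := by linarith
      refine Fin.strictAnti_iff_succ_lt.2 fun i ↦ ?_
      fin_cases i
      · show (c - y 1)⁻¹ < (c - y 0)⁻¹
        exact (inv_neg''.2 (hc1.trans (hc2.trans hc3))).trans (inv_pos.2 hc0)
      · show (c - y 2)⁻¹ < (c - y 1)⁻¹
        exact (inv_lt_inv_of_neg (hc2.trans hc3) (hc1.trans (hc2.trans hc3))).2 hc1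
      · show (c - y 3)⁻¹ < (c - y 2)⁻¹
        exact (inv_lt_inv_of_neg hc3 (hc2.trans hc3)).2 hc2
  · -- boundary values, transported along the Möbius map
    refine hasBoundaryValue_of_moebius (Φ := φ) (φ := φ') (g := invShiftSL c)
      (fun z _ ↦ rfl) (by simp [hx0 i]) ?_
    have : ((invShiftSL c) 0 0 * x i + (invShiftSL c) 0 1) / ((invShiftSL c) 1 0 * x i +
        (invShiftSL c) 1 1) = y i := by
      simp only [invShiftSL_apply_00, invShiftSL_apply_01, invShiftSL_apply_10,
        invShiftSL_apply_11, one_mul, add_zero, hx]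
      field_simp [hcy i]
      ring
    rw [this]
    exact hbv i
  · -- the cross-ratio is unchanged
    have h02 : c - y 0 ≠ c - y 2 := by
      rcases hy with ⟨h1, h2, h3⟩ | ⟨h1, h2, h3⟩ <;> intro h <;> linarith
    have h13 : c - y 1 ≠ c - y 3 := by
      rcases hy with ⟨h1, h2, h3⟩ | ⟨h1, h2, h3⟩ <;> intro h <;> linarith
    rw [hx, crossRatio_inv (fun i ↦ c - y i) hcy h02 h13]
    have : (fun i ↦ c - y i) = fun i ↦ (-1) * y i + c := by ext i; ring
    rw [this, crossRatio_affine y (by norm_num) c]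

end ConformalRectangle

/-! ### Anti-conformal affine maps and the reflected uniformizing map -/

/-- The anti-conformal real-affine map `z ↦ u z̄ + v` of the plane (for `‖u‖ = 1`,
`u v̄ + v = 0` this is the reflection in a line; e.g. `u = w²`, `v = 0`: the reflection in the
line `ℝ w`, `‖w‖ = 1`). [folklore] -/
def antiAffine (u v : ℂ) (z : ℂ) : ℂ := u * conj z + v

/-- `antiAffine u v` acts as `z ↦ u z̄ + v`. [folklore] -/
@[simp] theorem antiAffine_apply (u v z : ℂ) : antiAffine u v z = u * conj z + v := rfl

/-- `antiAffine u v` is continuous. [folklore] -/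
theorem continuous_antiAffine (u v : ℂ) : Continuous (antiAffine u v) := by
  unfold antiAffine; fun_prop

/-- For `‖u‖ = 1` and `u v̄ + v = 0`, `antiAffine u v` is an involution. [folklore] -/
theorem antiAffine_antiAffine {u v : ℂ} (hu : ‖u‖ = 1) (huv : u * conj v + v = 0) (z : ℂ) :
    antiAffine u v (antiAffine u v z) = z := by
  have hu' : u * conj u = 1 := by
    rw [mul_conj, Complex.normSq_eq_norm_sq, hu]; simp
  simp only [antiAffine_apply, map_add, map_mul, conj_conj]
  linear_combination z * hu' + huv

/-- The anti-conformal involution `κ z = -z̄` of `ℍₒ` (reflection in the imaginary axis). [folklore] -/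
theorem neg_conj_mem_upperHalfPlaneSet {z : ℂ} (hz : z ∈ upperHalfPlaneSet) :
    -conj z ∈ upperHalfPlaneSet := by
  show 0 < (-conj z).im
  simpa using (show 0 < z.im from hz)

namespace ConformalEquiv

variable {V : Set ℂ}

/-- **The reflected uniformizing map.** For a conformal equivalence `φ : ℍₒ → V` and an
anti-conformal affine involution `ρ = antiAffine u v` mapping `V` into itself, the map
`ψ = ρ ∘ φ ∘ κ`, `κ z = -z̄`, is again a conformal equivalence `ℍₒ → V` (two orientation
reversals compose to a holomorphic map: `conj ∘ f ∘ conj` is holomorphic iff `f` is).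
Ahlfors (1979), Ch. 4 §6.5. [cite: AhlforsCA1979, Ch. 4 §6.5] -/
def antiConj (φ : ConformalEquiv upperHalfPlaneSet V) (hV : IsOpen V) {u v : ℂ} (hu : ‖u‖ = 1)
    (huv : u * conj v + v = 0) (hmaps : MapsTo (antiAffine u v) V V) :
    ConformalEquiv upperHalfPlaneSet V where
  toFun z := antiAffine u v (φ (-conj z))
  invFun w := -conj (φ.symm (antiAffine u v w))
  source := upperHalfPlaneSet
  target := V
  map_source' z hz := hmaps (φ.mapsTo (neg_conj_mem_upperHalfPlaneSet hz))
  map_target' w hw := neg_conj_mem_upperHalfPlaneSet (φ.symm_mapsTo (hmaps hw))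
  left_inv' z hz := by
    rw [antiAffine_antiAffine hu huv, φ.symm_apply_apply (neg_conj_mem_upperHalfPlaneSet hz)]
    simp
  right_inv' w hw := by
    rw [show -conj (-conj (φ.symm (antiAffine u v w))) = φ.symm (antiAffine u v w) by simp,
      φ.apply_symm_apply (hmaps hw), antiAffine_antiAffine hu huv]
  source_eq := rfl
  target_eq := rfl
  differentiableOn := by
    intro z hz
    have h1 : DifferentiableAt ℂ (conj ∘ (fun y ↦ φ (-y)) ∘ conj) z := by
      rw [differentiableAt_conj_conj_iff]
      have hz' : -conj z ∈ upperHalfPlaneSet := neg_conj_mem_upperHalfPlaneSet hz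
      have hφ : DifferentiableAt ℂ φ (-conj z) :=
        (φ.differentiableOn _ hz').differentiableAt (isOpen_upperHalfPlaneSet.mem_nhds hz')
      exact hφ.comp _ (differentiable_neg _)
    have h2 : DifferentiableAt ℂ (fun z ↦ u * (conj ∘ (fun y ↦ φ (-y)) ∘ conj) z + v) z :=
      (h1.const_mul u).add_const v
    refine h2.differentiableWithinAt.congr (fun y _ ↦ ?_) ?_ <;>
      simp [antiAffine, Function.comp_def]
  differentiableOn_symm := by
    intro w hw
    have hw' : antiAffine u v w ∈ V := hmaps hw
    have h1 : DifferentiableAt ℂ (conj ∘ (fun y ↦ φ.symm (u * y + v)) ∘ conj) w := by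
      rw [differentiableAt_conj_conj_iff]
      have hφ : DifferentiableAt ℂ φ.symm (u * conj w + v) :=
        (φ.symm.differentiableOn _ hw').differentiableAt (hV.mem_nhds hw')
      exact hφ.comp (conj w) (by fun_prop : DifferentiableAt ℂ (fun y ↦ u * y + v) (conj w))
    refine (h1.neg).differentiableWithinAt.congr (fun y _ ↦ ?_) ?_ <;>
      simp [antiAffine, Function.comp_def]

/-- The reflected uniformizing map acts as `z ↦ ρ (φ (-z̄))`. [folklore] -/
@[simp] theorem antiConj_apply (φ : ConformalEquiv upperHalfPlaneSet V) (hV : IsOpen V) {u v : ℂ}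
    (hu : ‖u‖ = 1) (huv : u * conj v + v = 0) (hmaps : MapsTo (antiAffine u v) V V) (z : ℂ) :
    φ.antiConj hV hu huv hmaps z = antiAffine u v (φ (-conj z)) := rfl

/-- Boundary values of the reflected map: if `φ → p` at the real point `x`, then
`ρ ∘ φ ∘ κ → ρ p` at `-x`. [folklore] -/
theorem antiConj_hasBoundaryValue (φ : ConformalEquiv upperHalfPlaneSet V) (hV : IsOpen V)
    {u v : ℂ} (hu : ‖u‖ = 1) (huv : u * conj v + v = 0) (hmaps : MapsTo (antiAffine u v) V V)
    {x : ℝ} {p : ℂ} (h : φ.HasBoundaryValue x p) :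
    (φ.antiConj hV hu huv hmaps).HasBoundaryValue (-x : ℝ) (antiAffine u v p) := by
  have hκ : Tendsto (fun z : ℂ ↦ -conj z) (𝓝[upperHalfPlaneSet] ((-x : ℝ) : ℂ))
      (𝓝[upperHalfPlaneSet] (x : ℂ)) := by
    have hc : Continuous fun z : ℂ ↦ -conj z := by fun_prop
    have h1 : Tendsto (fun z : ℂ ↦ -conj z) (𝓝 ((-x : ℝ) : ℂ)) (𝓝 (x : ℂ)) := by
      have := hc.tendsto ((-x : ℝ) : ℂ)
      simpa [conj_ofReal] using this
    refine tendsto_nhdsWithin_of_tendsto_nhds_of_eventually_within _ (h1.mono_left nhdsWithin_le_nhds) ?_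
    exact eventually_mem_nhdsWithin.mono fun z hz ↦ neg_conj_mem_upperHalfPlaneSet hz
  have hρ : Tendsto (antiAffine u v) (𝓝 p) (𝓝 (antiAffine u v p)) :=
    (continuous_antiAffine u v).tendsto p
  exact hρ.comp (h.comp hκ)

end ConformalEquiv

/-! ### The symmetry principle -/

namespace ConformalRectangle

/-- **A reflection-symmetric conformal rectangle is conformally a square.** Let `(D; a, b, c, d)`
be a conformal rectangle and `ρ z = u z̄ + v` (`‖u‖ = 1`, `u v̄ + v = 0`) an anti-conformal affine
involution with `ρ(D) ⊆ D`, `ρ a = a`, `ρ c = c` and `ρ b = d`. Then every uniformizing datum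
`(φ, x)` has `crossRatio x = 1/2`. Proof: `ρ ∘ φ ∘ κ` uniformizes `(D; a, b, c, d)` with the tuple
`(-x₀, -x₃, -x₂, -x₁)`, of cross-ratio `1 - η` (`crossRatio_neg_perm_0321`), renormalised by
`exists_isUniformizing_of_cyclic`; conformal invariance of the cross-ratio
(`crossRatio_eq_of_isUniformizing_of_disc exists_continuousOn_extension_holds`) forces `η = 1 - η`.
This is the "by symmetry" step of Beffara (2008), proof of Prop. 4; Ahlfors (1979), Ch. 4 §6.5 and
Ch. 6 §1.1. [cite: AhlforsCA1979, Ch. 4 §6.5] -/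
theorem crossRatio_eq_half_of_antiAffine (R : ConformalRectangle) {u v : ℂ} (hu : ‖u‖ = 1)
    (huv : u * conj v + v = 0) (hmaps : MapsTo (antiAffine u v) R.carrier R.carrier)
    (h0 : antiAffine u v (R.pt 0) = R.pt 0) (h2 : antiAffine u v (R.pt 2) = R.pt 2)
    (h1 : antiAffine u v (R.pt 1) = R.pt 3) {φ : ConformalEquiv upperHalfPlaneSet R.carrier}
    {x : Fin 4 → ℝ} (h : R.IsUniformizing φ x) : crossRatio x = 1 / 2 := by
  have h3 : antiAffine u v (R.pt 3) = R.pt 1 := by rw [← h1, antiAffine_antiAffine hu huv]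
  set ψ := φ.antiConj R.isOpen hu huv hmaps with hψ
  -- boundary values of `ψ` at `-x i`
  have hb : ∀ i, ψ.HasBoundaryValue (-x i : ℝ) (antiAffine u v (R.pt i)) := fun i ↦
    φ.antiConj_hasBoundaryValue R.isOpen hu huv hmaps (h.2 i)
  set y : Fin 4 → ℝ := ![-x 0, -x 3, -x 2, -x 1] with hy
  have hby : ∀ i, ψ.HasBoundaryValue (y i) (R.pt i) := by
    have e0 := hb 0; have e1 := hb 1; have e2 := hb 2; have e3 := hb 3
    rw [h0] at e0; rw [h1] at e1; rw [h2] at e2; rw [h3] at e3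
    intro i
    fin_cases i
    · simpa [hy] using e0
    · simpa [hy] using e3
    · simpa [hy] using e2
    · simpa [hy] using e1
  have hinj := h.injective
  have h01 : (0 : Fin 4) < 1 := by decide
  have h12 : (1 : Fin 4) < 2 := by decide
  have h23 : (2 : Fin 4) < 3 := by decide
  have hcyc : (y 1 < y 2 ∧ y 2 < y 3 ∧ y 3 < y 0) ∨ (y 0 < y 3 ∧ y 3 < y 2 ∧ y 2 < y 1) := by
    rcases h.1 with hm | hm
    · left
      have a := hm h01; have b := hm h12; have c := hm h23
      simp only [hy, Matrix.cons_val_zero, Matrix.cons_val_one, Matrix.cons_val]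
      exact ⟨by linarith, by linarith, by linarith⟩
    · right
      have a := hm h01; have b := hm h12; have c := hm h23
      simp only [hy, Matrix.cons_val_zero, Matrix.cons_val_one, Matrix.cons_val]
      exact ⟨by linarith, by linarith, by linarith⟩
  obtain ⟨φ', x', hux', hcr'⟩ := R.exists_isUniformizing_of_cyclic ψ y hby hcyc
  have hwd : crossRatio x' = crossRatio x :=
    crossRatio_eq_of_isUniformizing_of_disc JordanDomain.exists_continuousOn_extension_holds hux' h
  have hx02 : x 0 ≠ x 2 := fun e ↦ by simpa using hinj e
  have hx13 : x 1 ≠ x 3 := fun e ↦ by simpa using hinj e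
  have key : crossRatio y = 1 - crossRatio x := by
    rw [hy]; exact crossRatio_neg_perm_0321 x hx02 hx13
  have : crossRatio x = 1 - crossRatio x := by rw [← key, ← hcr', hwd]
  linarith

/-- The unit disc is mapped into itself by the reflection `z ↦ w² z̄` in the line `ℝ w`
(`‖w‖ = 1`). [folklore] -/
theorem mapsTo_antiAffine_sq_ball {w : ℂ} (hw : ‖w‖ = 1) :
    MapsTo (antiAffine (w ^ 2) 0) (ball (0 : ℂ) 1) (ball 0 1) := by
  intro z hz
  rw [mem_ball_zero_iff] at hz ⊢
  simpa [antiAffine, norm_pow, hw] using hz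

end ConformalRectangle

end Literature.Probability.RandomPlanarGeometry
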